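import Summits.CriticalPhenomena.CardyFormulaZ2.Theorems.CardyUniqueLimitCardyRigiditySlitCrossingTransfer
import Literature.Probability.RandomPlanarGeometry.ConformalRectangle
import HarnessLib

/-!
# Flower position and flower existence for conformal rectangles (vocabulary, shape-checked)

Crux `Summit.CriticalPhenomena.CardyFormulaZ2.Theses.CardyUniqueLimit.CardyRigidity`
(stmt-CriticalPhenomena-0746), line `crossing_martingale`, stub `stub_slitObservableApprox`,
piece **(P-flower)** (worker A3b of lead c2; UNLANDED vocabulary).  Camia–Newman's flower
domains (PTRF 139 (2007), Lemma 7.3: inner/outer conformal rectangles `R̃(ε)`, `R̂(ε)` of a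
conformal rectangle `R`, built from the interior and exterior Riemann maps, with moduli
`→ modulus(R)`) enter the crux only through the metric hypotheses (H1)–(H6) of the landed
transfer lemma `slitCrossing_discreteCrossing_subset_of_margins` (…SlitCrossingTransfer.lean)
and the squeeze `slitCrossing_tendsto_measureReal_of_sandwich` (…SlitCrossingSqueeze.lean).
This file fixes the SHAPE of the flower-existence statement so that both apply verbatim:

* `Flower.Position Ω₁ A₁ B₁ Ω₂ A B δ m m₂` — (H1)–(H5) of the transfer lemma at mesh `δ` with
  margin `m`, plus the shallowness clause feeding (H6) through `Transfer.h6_of_bulk` at depth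
  `m₂`; `Flower.subset_of_position` — **proved**: a flower position and the bulk property of
  `Ω₂` at depth `m₂` give `discreteCrossing Ω₁ δ A₁ B₁ ⊆ discreteCrossing Ω₂ δ A B`;
  `Flower.position_of_le` — positions persist to smaller meshes;
* `Flower.CloseTo R κ Ω A B` — the competitor `(Ω; A, B)` is `κ`-close to the conformal
  rectangle `R` (domain sandwich, frontier closeness, arcwise closeness of `A`, `B` to
  `R.arc 0`, `R.arc 2`, the rest of `∂Ω` close to `R.arc 1 ∪ R.arc 3`); `Flower.closeTo_mono`;
* `Flower.InnerExistence R`, `Flower.OuterExistence R` — for every uniformizing datum `(φ, x)`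
  of `R` and `ε > 0`: a conformal rectangle with uniformizing datum of cross-ratio within `ε` of
  `crossRatio x` which is in flower position against EVERY `κ`-close competitor at mesh `δ₀`
  (inner: the flower is the source triple; outer: the flower is the target triple).  The moduli
  clause is to be discharged through the tree's
  `ConformalRectangle.tendsto_crossRatio_of_tendstoUniformly` (CrossRatioContinuity.lean: Radó)
  once the flower loops converge uniformly to `R.boundary`; the positional clauses are CN07's
  "strictly positive minimal distances".
Nothing is asserted by the predicates (parametrised sub-goals of this route, not Literature
facts: the statement with uniform validity against all close competitors is not in print).
-/

noncomputable section

open Set Metric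
open Literature.Probability.LatticeModels Literature.Probability.Percolation
open Literature.Probability.RandomPlanarGeometry

namespace Summit.CriticalPhenomena.CardyFormulaZ2.Cruxes.CardyRigidity.CrossingMartingale

namespace Flower

/-- **Flower position** of a source triple `(Ω₁; A₁, B₁)` against a target triple `(Ω₂; A, B)`
at mesh `δ` with margin `m` and depth `m₂`: `Ω₁, Ω₂` open, `0 < δ < m`, hypotheses (H1)–(H5) of
`slitCrossing_discreteCrossing_subset_of_margins`, and the shallowness clause of
`Transfer.h6_of_bulk` (points of `Ω₁ ∩ Ω₂` within `m₂` of `∂Ω₂` are `A`- or `B`-close).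
(Source: Camia–Newman 2007, Lemma 7.3.  A predicate of this route — deliberately NOT a cited
Literature fact.) -/
def Position (Ω₁ A₁ B₁ Ω₂ A B : Set ℂ) (δ m m₂ : ℝ) : Prop :=
  IsOpen Ω₁ ∧ IsOpen Ω₂ ∧ 0 < δ ∧ δ < m ∧
  (∀ z ∈ Ω₁, infDist z A₁ ≤ δ → infDist z A < m ∧ z ∉ Ω₂) ∧
  (∀ z ∈ Ω₁, infDist z B₁ ≤ δ → infDist z B < m ∧ z ∉ Ω₂) ∧
  (∀ z, infDist z A < m → m + δ ≤ infDist z B) ∧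
  (∀ f ∈ closure Ω₁ ∩ frontier Ω₂,
    (f ∈ A ∧ 2 * δ ≤ infDist f (frontier Ω₂ \ A)) ∨ (f ∈ B ∧ 2 * δ ≤ infDist f (frontier Ω₂ \ B))) ∧
  (∀ z ∈ Ω₁, z ∉ Ω₂ → infDist z A < m ∨ infDist z B < m) ∧
  (∀ z ∈ Ω₁ ∩ Ω₂, infDist z (frontier Ω₂) < m₂ → infDist z A < m ∨ infDist z B < m)

variable {Ω₁ A₁ B₁ Ω₂ A B : Set ℂ} {δ δ' m m₂ : ℝ}

/-- **A flower position transfers crossings** (the landed transfer lemma with (H6) from the bulk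
property of `Ω₂` at depth `m₂`). [cite: CamiaNewman2007, Thm 3 and Lemma 7.3] -/
theorem subset_of_position (h : Position Ω₁ A₁ B₁ Ω₂ A B δ m m₂)
    (hbulk : ∀ v : Site 2, meshPoint δ v ∈ Ω₂ → m₂ ≤ infDist (meshPoint δ v) (frontier Ω₂) →
      v ∈ meshDomain Ω₂ δ) :
    discreteCrossing Ω₁ δ A₁ B₁ ⊆ discreteCrossing Ω₂ δ A B := by
  obtain ⟨ho₁, ho₂, hδ, hδm, h1, h2, h3, h4, h5, hsh⟩ := h
  exact slitCrossing_discreteCrossing_subset_of_margins Ω₁ Ω₂ A₁ B₁ A B δ m ho₁ ho₂ hδ hδm h1 h2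
    h3 h4 h5 (Transfer.h6_of_bulk hbulk hsh)

/-- Flower positions persist to smaller positive meshes. [folklore] -/
theorem position_of_le (h : Position Ω₁ A₁ B₁ Ω₂ A B δ m m₂) (hδ' : 0 < δ') (hle : δ' ≤ δ) :
    Position Ω₁ A₁ B₁ Ω₂ A B δ' m m₂ := by
  obtain ⟨ho₁, ho₂, -, hδm, h1, h2, h3, h4, h5, hsh⟩ := h
  refine ⟨ho₁, ho₂, hδ', hle.trans_lt hδm, fun z hz hd ↦ h1 z hz (hd.trans hle),
    fun z hz hd ↦ h2 z hz (hd.trans hle), fun z hz ↦ ?_, fun f hf ↦ ?_, h5, hsh⟩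
  · linarith [h3 z hz]
  · rcases h4 f hf with ⟨hfA, hd⟩ | ⟨hfB, hd⟩
    · exact Or.inl ⟨hfA, by linarith⟩
    · exact Or.inr ⟨hfB, by linarith⟩

/-- **`κ`-closeness of a competitor `(Ω; A, B)` to the conformal rectangle `R`**: `Ω` open;
domain sandwich (points of `R` at distance `≥ κ` from `Rᶜ` lie in `Ω`, `Ω` lies within `κ` of
`R`); frontier of `Ω` within `κ` of `∂R`; the arcs `A, B ⊆ ∂Ω` arcwise `κ`-close to `R.arc 0`,
`R.arc 2` (both directions); the rest of `∂Ω` within `κ` of `R.arc 1 ∪ R.arc 3`.  Satisfied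
eventually, for every `κ > 0`, by conformal rectangles whose boundary loops converge uniformly to
`R.boundary` with mark parameters converging (cf. `Bulk.subset_carrier_of_close`,
`Bulk.carrier_subset_of_close`, `Bulk.frontier_subset_of_close`).
(Source: Camia–Newman 2007, Lemma 7.3.  A predicate of this route — deliberately NOT a cited
Literature fact.) -/
def CloseTo (R : ConformalRectangle) (κ : ℝ) (Ω A B : Set ℂ) : Prop :=
  IsOpen Ω ∧ {z ∈ R.carrier | κ ≤ infDist z R.carrierᶜ} ⊆ Ω ∧ Ω ⊆ {z | infDist z R.carrier < κ} ∧
  frontier Ω ⊆ {z | infDist z (frontier R.carrier) < κ} ∧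
  R.arc 0 ⊆ {z | infDist z A < κ} ∧ A ⊆ {z | infDist z (R.arc 0) < κ} ∧
  R.arc 2 ⊆ {z | infDist z B < κ} ∧ B ⊆ {z | infDist z (R.arc 2) < κ} ∧
  A ⊆ frontier Ω ∧ B ⊆ frontier Ω ∧
  frontier Ω \ (A ∪ B) ⊆ {z | infDist z (R.arc 1 ∪ R.arc 3) < κ}

/-- Closeness is monotone in the tolerance. [folklore] -/
theorem closeTo_mono {R : ConformalRectangle} {κ κ' : ℝ} {Ω A B : Set ℂ} (h : CloseTo R κ Ω A B)
    (hκ : κ ≤ κ') : CloseTo R κ' Ω A B := by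
  obtain ⟨ho, hin, hout, hfr, hA1, hA2, hB1, hB2, hAf, hBf, hrest⟩ := h
  exact ⟨ho, fun z hz ↦ hin ⟨hz.1, hκ.trans hz.2⟩, fun z hz ↦ lt_of_lt_of_le (hout hz) hκ,
    fun z hz ↦ lt_of_lt_of_le (hfr hz) hκ, fun z hz ↦ lt_of_lt_of_le (hA1 hz) hκ,
    fun z hz ↦ lt_of_lt_of_le (hA2 hz) hκ, fun z hz ↦ lt_of_lt_of_le (hB1 hz) hκ,
    fun z hz ↦ lt_of_lt_of_le (hB2 hz) hκ, hAf, hBf, fun z hz ↦ lt_of_lt_of_le (hrest hz) hκ⟩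

/-- **Inner flower existence for `R`** (Camia–Newman's `D̃(ε)`): for every uniformizing datum
`(φ, x)` of `R` and `ε > 0`, a conformal rectangle `R₁` with a uniformizing datum of cross-ratio
within `ε` of `crossRatio x`, a margin `m`, a depth `m₂ > 0`, a tolerance `κ > 0` and a mesh
`δ₀ > 0`, such that `(R₁; R₁.arc 0, R₁.arc 2)` is in flower position against every `κ`-close
competitor at mesh `δ₀` (hence at all smaller meshes, `position_of_le`).
(Sources: Camia–Newman 2007, Lemma 7.3; Pommerenke 1992, Thm 2.11 (Radó) for the moduli.  A
sub-goal of the crux, stated as a predicate of this route — deliberately NOT a cited Literature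
fact.) -/
def InnerExistence (R : ConformalRectangle) : Prop :=
  ∀ (φ : ConformalEquiv UpperHalfPlane.upperHalfPlaneSet R.carrier) (x : Fin 4 → ℝ),
    R.IsUniformizing φ x → ∀ ε : ℝ, 0 < ε →
      ∃ (R₁ : ConformalRectangle) (φ₁ : ConformalEquiv UpperHalfPlane.upperHalfPlaneSet R₁.carrier)
        (x₁ : Fin 4 → ℝ), R₁.IsUniformizing φ₁ x₁ ∧ |crossRatio x₁ - crossRatio x| ≤ ε ∧
        ∃ m m₂ κ δ₀ : ℝ, 0 < m₂ ∧ 0 < κ ∧ 0 < δ₀ ∧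
          ∀ (Ω A B : Set ℂ), CloseTo R κ Ω A B →
            Position R₁.carrier (R₁.arc 0) (R₁.arc 2) Ω A B δ₀ m m₂

/-- **Outer flower existence for `R`** (Camia–Newman's `D̂(ε)`, with its arcs enlarged by the
connecting curves): the same with the flower as the TARGET triple — every `κ`-close competitor
is in flower position against `(R₂; R₂.arc 0, R₂.arc 2)` at mesh `δ₀`.  (For the transfer one
also needs the bulk property of the fixed Jordan domain `R₂` at depth `m₂`, available from
`JordanDomain.exists_forall_mem_meshDomain_and_reachable`.)
(Source: Camia–Newman 2007, Lemma 7.3.  A sub-goal of the crux, stated as a predicate of this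
route — deliberately NOT a cited Literature fact.) -/
def OuterExistence (R : ConformalRectangle) : Prop :=
  ∀ (φ : ConformalEquiv UpperHalfPlane.upperHalfPlaneSet R.carrier) (x : Fin 4 → ℝ),
    R.IsUniformizing φ x → ∀ ε : ℝ, 0 < ε →
      ∃ (R₂ : ConformalRectangle) (φ₂ : ConformalEquiv UpperHalfPlane.upperHalfPlaneSet R₂.carrier)
        (x₂ : Fin 4 → ℝ), R₂.IsUniformizing φ₂ x₂ ∧ |crossRatio x₂ - crossRatio x| ≤ ε ∧
        ∃ m m₂ κ δ₀ : ℝ, 0 < m₂ ∧ 0 < κ ∧ 0 < δ₀ ∧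
          ∀ (Ω A B : Set ℂ), CloseTo R κ Ω A B →
            Position Ω A B R₂.carrier (R₂.arc 0) (R₂.arc 2) δ₀ m m₂

end Flower

/-- **Registered form** (glue `flower_subset_of_position` of stmt-CriticalPhenomena-0746): a flower position plus the bulk
property of the target domain transfers discrete crossings. [cite: CamiaNewman2007, Thm 3 and Lemma 7.3] -/
theorem flower_subset_of_position : ∀ {Ω₁ A₁ B₁ Ω₂ A B : Set ℂ} {δ m m₂ : ℝ}, Flower.Position Ω₁ A₁ B₁ Ω₂ A B δ m m₂ → (∀ v : Site 2, meshPoint δ v ∈ Ω₂ → m₂ ≤ infDist (meshPoint δ v) (frontier Ω₂) → v ∈ meshDomain Ω₂ δ) → discreteCrossing Ω₁ δ A₁ B₁ ⊆ discreteCrossing Ω₂ δ A B :=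
  fun h hbulk ↦ Flower.subset_of_position h hbulk

end Summit.CriticalPhenomena.CardyFormulaZ2.Cruxes.CardyRigidity.CrossingMartingale

end
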